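import Mathlib
import Summits.CriticalPhenomena.CardyFormulaZ2.Theorems.CardySelfRefinementDefs
import Summits.CriticalPhenomena.CardyFormulaZ2.Theorems.CardySelfRefinementTrivialSectorRateStubFourArmAboveOneCircuitsDuality
import Summits.CriticalPhenomena.CardyFormulaZ2.Theorems.CardySelfRefinementTrivialSectorRateStubFourArmAboveOneCircuitsBounds
import Literature.Probability.Percolation.ThinAnnulusCircuits
import Literature.Probability.Percolation.IsoradialProofs
import Literature.Probability.Percolation.SelfRefinementMeasure
import HarnessLib

/-!
# Helper `circuitsAlong` (M1) of stub `stub_fourArmAboveOne`, line `far-field-is-a-quarter-turn`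
(crux `TrivialSectorRate`, stmt-CriticalPhenomena-10266): thin-annulus circuits for `M_k(γ s)`

**(M1)** Along an admissible RSW path `γ` (`PathOK k γ`) and for every aspect-ratio bound `K`,
there are `ρ_K > 0` and `a₀` such that for all `s`, every centre `c` and all radii
`a₀ ≤ a < b` with `2b ≤ K (b - a)`, the square annulus `c + A_{a,b}` contains an open circuit
around `c`, and the dual annulus a closed dual circuit, each with `M_k(γ s)`-probability `≥ ρ_K`
(`circuitsAlong`, registered helper; the RSW half of Garban's (B.3) for the dependent model).

Proof (Grimmett 1999, §11.7, (11.78), run for the measure `M_k(γ s)`):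
* the RSW input is the clause `BoxCrossingBounds (M k (γ s).1 (γ s).2) squareLatticeEmbedding.z ρ c₀ n₀`
  of `PathOK`, uniform in `s`, used at the two aspect ratios `ρ = K` (LOWER bounds `≥ c₁` for
  long-way crossings of `K n × n` rectangles) and `ρ = 1/K` (UPPER bounds `≤ 1 - c₂` for
  short-way crossings); the dictionary between the embedded crossing events of the drawing
  `√2 ℤ² - w` and crossings of lattice rectangles is the tree's
  (`mem_shift_lrCrossing_of_mem_embRectCrossing`, `shift_lrCrossing_subset_embRectCrossing`) plus
  its vertical companion `shift_tbCrossing_subset_embTBCrossing`; vertical LOWER bounds are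
  reduced to horizontal ones by the transposition invariance of `M_k`
  (`selfRefinementMeasure_real_preimage_relabel_transpose`, `M_real_tbCrossingAt_eq`; file
  `…CircuitsBounds`);
* open circuit: Harris–FKG for the positively associated measure `M_k`
  (`isPositivelyAssociated_selfRefinementMeasure`) glues the four long-way crossings
  (`mem_openCircuitInAnnulusAt_of_crossings`, file `…CircuitsDuality`): probability `≥ c₁⁴`;
* dual circuit (no self-duality for `M_k`): the complements of the four short-way crossing
  events are decreasing, of probability `≥ c₂` each, positively correlated as well, and on their
  intersection planar duality produces the closed dual circuit
  (`mem_dualCircuitInAnnulusAt_of_not_crossings`): probability `≥ c₂⁴`;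
* `a₀ = K (n₁ + n₂ + 1)` makes `b - a > 2 (n₁ + n₂ + 1)` exceed both RSW thresholds.

References: G. Grimmett, *Percolation* (1999), §11.7; O. Schramm, S. Smirnov (app. C. Garban),
Ann. Probab. 39 (2011), App. B, (B.3); L. Russo (1978); P. Seymour, D. Welsh (1978).
-/

noncomputable section

namespace Summit.CriticalPhenomena.CardyFormulaZ2.Theorems.CardySelfRefinement.FarField

open Set MeasureTheory
open Literature.Probability.LatticeModels Literature.Probability.Percolation
open Literature.Probability.Percolation.QuadCrossing
open Summit.CriticalPhenomena.CardyFormulaZ2.Theses.CardySelfRefinement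

/-! ### The helper (M1) -/

/-- **(M1) Thin-annulus open and dual circuits along an RSW path.**  For `PathOK k γ` and `K ≥ 1`
there are `ρ_K > 0` and `a₀` such that for every path parameter `s`, every centre `c` and all radii
`a₀ ≤ a < b` with `2b ≤ K (b - a)`, both the open circuit of `c + A_{a,b}` around `c` and the
closed dual circuit of the dual annulus have `M_k(γ s)`-probability at least `ρ_K` (RSW dictionary
from `BoxCrossingBounds` at aspect ratios `K` and `1/K`, Harris–FKG for the positively associated
measure `M_k`, planar duality for the dual circuit; Grimmett 1999 §11.7 (11.78) for `M_k`). -/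
theorem circuitsAlong {k : ℕ} (hk : k = 2 ∨ k = 3) {γ : unitInterval → ℝ × ℝ} (hγ : PathOK k γ)
    {K : ℕ} (hK : 1 ≤ K) :
    ∃ ρs : ℝ, 0 < ρs ∧ ∃ a₀ : ℕ, ∀ (s : unitInterval) (c : Site 2) (a b : ℕ), a₀ ≤ a → a < b →
      2 * b ≤ K * (b - a) →
        ρs ≤ (M k (γ s).1 (γ s).2).real (openCircuitInAnnulusAt c a b) ∧
        ρs ≤ (M k (γ s).1 (γ s).2).real (dualCircuitInAnnulusAt c a b) := by
  have _ := hk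
  obtain ⟨-, -, -, -, -, -, hbox⟩ := hγ
  have hK0 : (0 : ℝ) < K := by exact_mod_cast hK
  have hK1 : (1 : ℝ) ≤ K := by exact_mod_cast hK
  obtain ⟨c₁, hc₁, n₁, h₁⟩ := hbox (K : ℝ) hK0
  obtain ⟨c₂, hc₂, n₂, h₂⟩ := hbox (1 / (K : ℝ)) (by positivity)
  refine ⟨min (c₁ ^ 4) (c₂ ^ 4), lt_min (by positivity) (by positivity), K * (n₁ + n₂ + 1), ?_⟩
  intro s c a b ha hab hKab
  have hs := one_lt_sqrt_two_and_lt_two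
  have hs0 : 0 < Real.sqrt 2 := by linarith
  -- the measure
  haveI : IsProbabilityMeasure (M k (γ s).1 (γ s).2) :=
    instIsProbabilityMeasureSelfRefinementMeasure k _ _
  have hae : ∀ᵐ ω ∂(M k (γ s).1 (γ s).2), ω ⊆ (zdGraph 2).edgeSet :=
    selfRefinementMeasure_ae_subset_edgeSet k _ _
  have hPA : IsPositivelyAssociated (M k (γ s).1 (γ s).2) :=
    isPositivelyAssociated_selfRefinementMeasure k _ _
  -- integer bookkeeping
  have hN : n₁ + n₂ + 1 < b - a := by
    have h3 : K * (2 * (n₁ + n₂ + 1)) < K * (b - a) := by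
      have : K * (2 * (n₁ + n₂ + 1)) = 2 * (K * (n₁ + n₂ + 1)) := by ring
      omega
    have h4 := Nat.lt_of_mul_lt_mul_left h3
    omega
  have ha1 : 1 ≤ a := by
    have := Nat.mul_le_mul hK (show 1 ≤ n₁ + n₂ + 1 by omega)
    omega
  have h2b : 1 ≤ 2 * b := by omega
  -- real bookkeeping
  have hX0 : (0 : ℝ) ≤ ((b - a : ℕ) : ℝ) := Nat.cast_nonneg _
  have hKab' : (2 : ℝ) * b ≤ K * ((b - a : ℕ) : ℝ) := by exact_mod_cast hKab
  have hn₁X : (n₁ : ℝ) + 1 ≤ ((b - a : ℕ) : ℝ) := by exact_mod_cast (show n₁ + 1 ≤ b - a by omega)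
  have hn₂X : (n₂ : ℝ) + 1 ≤ ((b - a : ℕ) : ℝ) := by exact_mod_cast (show n₂ + 1 ≤ b - a by omega)
  -- the lower-bound scale `nlo` (aspect ratio `K`)
  set nlo : ℕ := ⌊Real.sqrt 2 * ((b - a : ℕ) : ℝ)⌋₊ + 1 with hnlo
  have hlo1 : (nlo : ℝ) ≤ Real.sqrt 2 * ((b - a : ℕ) : ℝ) + 1 := by
    rw [hnlo]; push_cast
    linarith [Nat.floor_le (show (0 : ℝ) ≤ Real.sqrt 2 * ((b - a : ℕ) : ℝ) by positivity)]
  have hlo2 : Real.sqrt 2 * ((b - a : ℕ) : ℝ) < nlo := by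
    rw [hnlo]; push_cast
    exact Nat.lt_floor_add_one _
  have hlo_n : n₁ ≤ nlo := by
    have : (n₁ : ℝ) < nlo := by nlinarith
    exact_mod_cast this.le
  have hlo3 : Real.sqrt 2 * ((2 * b : ℕ) : ℝ) - 1 ≤ (K : ℝ) * nlo := by
    push_cast
    have e1 := mul_le_mul_of_nonneg_left hlo2.le hK0.le
    have e2 := mul_le_mul_of_nonneg_left hKab' hs0.le
    nlinarith
  -- the upper-bound scale `nhi` (aspect ratio `1/K`)
  set nhi : ℕ := ⌊(K : ℝ) * (Real.sqrt 2 * (((b - a : ℕ) : ℝ) + 1))⌋₊ with hnhi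
  have hhi1 : (nhi : ℝ) ≤ K * (Real.sqrt 2 * (((b - a : ℕ) : ℝ) + 1)) :=
    Nat.floor_le (by positivity)
  have hhi2 : (K : ℝ) * (Real.sqrt 2 * (((b - a : ℕ) : ℝ) + 1)) < nhi + 1 := Nat.lt_floor_add_one _
  have hhi_n : n₂ ≤ nhi := by
    refine Nat.le_floor ?_
    have e1 : ((b - a : ℕ) : ℝ) ≤ Real.sqrt 2 * (((b - a : ℕ) : ℝ) + 1) := by nlinarith
    have e2 : Real.sqrt 2 * (((b - a : ℕ) : ℝ) + 1) ≤ K * (Real.sqrt 2 * (((b - a : ℕ) : ℝ) + 1)) :=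
      le_mul_of_one_le_left (by positivity) hK1
    linarith
  have hhi3 : Real.sqrt 2 * ((2 * b - 1 : ℕ) : ℝ) ≤ nhi := by
    rw [Nat.cast_sub h2b]; push_cast
    have e1 := mul_le_mul_of_nonneg_left hKab' hs0.le
    have e2 := mul_le_mul_of_nonneg_right hK1 hs0.le
    nlinarith
  have hhi4 : Real.sqrt 2 * ((b - a + 1 : ℕ) : ℝ) - 2 ≤ 1 / (K : ℝ) * nhi := by
    rw [one_div_mul_eq_div, le_div_iff₀ hK0]; push_cast
    nlinarith
  have hhi5 : 1 / (K : ℝ) * nhi ≤ Real.sqrt 2 * ((b - a + 1 : ℕ) : ℝ) := by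
    rw [one_div_mul_eq_div, div_le_iff₀ hK0]; push_cast
    nlinarith
  -- the four long-way crossings (open circuit)
  have hOT : c₁ ≤ (M k (γ s).1 (γ s).2).real (lrCrossingAt (![-(b : ℤ), (a : ℤ)] + c) (2 * b) (b - a)) :=
    le_real_lrCrossingAt_of_boxCrossingBounds hae (h₁ s) _ (2 * b) (b - a) hlo_n hlo1 hlo3
  have hOB : c₁ ≤ (M k (γ s).1 (γ s).2).real (lrCrossingAt (![-(b : ℤ), -(b : ℤ)] + c) (2 * b) (b - a)) :=
    le_real_lrCrossingAt_of_boxCrossingBounds hae (h₁ s) _ (2 * b) (b - a) hlo_n hlo1 hlo3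
  have hOL : c₁ ≤ (M k (γ s).1 (γ s).2).real (openCrossing
      ((· + (![-(b : ℤ), -(b : ℤ)] + c)) '' (rectangle (b - a) (2 * b) : Set (Site 2)))
      ((· + (![-(b : ℤ), -(b : ℤ)] + c)) '' (bottomSide (b - a) (2 * b) : Set (Site 2)))
      ((· + (![-(b : ℤ), -(b : ℤ)] + c)) '' (topSide (b - a) (2 * b) : Set (Site 2)))) := by
    rw [M_real_tbCrossingAt_eq]
    exact le_real_lrCrossingAt_of_boxCrossingBounds hae (h₁ s) _ (2 * b) (b - a) hlo_n hlo1 hlo3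
  have hOR : c₁ ≤ (M k (γ s).1 (γ s).2).real (openCrossing
      ((· + (![(a : ℤ), -(b : ℤ)] + c)) '' (rectangle (b - a) (2 * b) : Set (Site 2)))
      ((· + (![(a : ℤ), -(b : ℤ)] + c)) '' (bottomSide (b - a) (2 * b) : Set (Site 2)))
      ((· + (![(a : ℤ), -(b : ℤ)] + c)) '' (topSide (b - a) (2 * b) : Set (Site 2)))) := by
    rw [M_real_tbCrossingAt_eq]
    exact le_real_lrCrossingAt_of_boxCrossingBounds hae (h₁ s) _ (2 * b) (b - a) hlo_n hlo1 hlo3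
  -- the four short-way crossings (dual circuit)
  have hPT : (M k (γ s).1 (γ s).2).real (openCrossing
      ((· + (![(1 : ℤ), 0] + (![-(b : ℤ), (a : ℤ)] + c))) '' (rectangle (2 * b - 1) (b - a + 1) : Set (Site 2)))
      ((· + (![(1 : ℤ), 0] + (![-(b : ℤ), (a : ℤ)] + c))) '' (bottomSide (2 * b - 1) (b - a + 1) : Set (Site 2)))
      ((· + (![(1 : ℤ), 0] + (![-(b : ℤ), (a : ℤ)] + c))) '' (topSide (2 * b - 1) (b - a + 1) : Set (Site 2))))
      ≤ 1 - c₂ :=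
    real_tbCrossingAt_le_of_boxCrossingBounds (h₂ s) _ (2 * b - 1) (b - a + 1) hhi_n hhi3 hhi4 hhi5
  have hPB : (M k (γ s).1 (γ s).2).real (openCrossing
      ((· + (![(1 : ℤ), 0] + (![-(b : ℤ), -(b : ℤ)] + c))) '' (rectangle (2 * b - 1) (b - a + 1) : Set (Site 2)))
      ((· + (![(1 : ℤ), 0] + (![-(b : ℤ), -(b : ℤ)] + c))) '' (bottomSide (2 * b - 1) (b - a + 1) : Set (Site 2)))
      ((· + (![(1 : ℤ), 0] + (![-(b : ℤ), -(b : ℤ)] + c))) '' (topSide (2 * b - 1) (b - a + 1) : Set (Site 2))))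
      ≤ 1 - c₂ :=
    real_tbCrossingAt_le_of_boxCrossingBounds (h₂ s) _ (2 * b - 1) (b - a + 1) hhi_n hhi3 hhi4 hhi5
  have hPL : (M k (γ s).1 (γ s).2).real
      (lrCrossingAt (![(0 : ℤ), 1] + (![-(b : ℤ), -(b : ℤ)] + c)) (b - a + 1) (2 * b - 1)) ≤ 1 - c₂ :=
    real_lrCrossingAt_le_of_boxCrossingBounds (h₂ s) _ (b - a + 1) (2 * b - 1) hhi_n hhi3 hhi4 hhi5
  have hPR : (M k (γ s).1 (γ s).2).real
      (lrCrossingAt (![(0 : ℤ), 1] + (![(a : ℤ), -(b : ℤ)] + c)) (b - a + 1) (2 * b - 1)) ≤ 1 - c₂ :=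
    real_lrCrossingAt_le_of_boxCrossingBounds (h₂ s) _ (b - a + 1) (2 * b - 1) hhi_n hhi3 hhi4 hhi5
  constructor
  · -- open circuit: Harris–FKG for the four increasing crossing events
    refine (min_le_left _ _).trans ?_
    set OT := lrCrossingAt (![-(b : ℤ), (a : ℤ)] + c) (2 * b) (b - a) with hOTd
    set OB := lrCrossingAt (![-(b : ℤ), -(b : ℤ)] + c) (2 * b) (b - a) with hOBd
    set OL := openCrossing
      ((· + (![-(b : ℤ), -(b : ℤ)] + c)) '' (rectangle (b - a) (2 * b) : Set (Site 2)))
      ((· + (![-(b : ℤ), -(b : ℤ)] + c)) '' (bottomSide (b - a) (2 * b) : Set (Site 2)))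
      ((· + (![-(b : ℤ), -(b : ℤ)] + c)) '' (topSide (b - a) (2 * b) : Set (Site 2))) with hOLd
    set OR := openCrossing
      ((· + (![(a : ℤ), -(b : ℤ)] + c)) '' (rectangle (b - a) (2 * b) : Set (Site 2)))
      ((· + (![(a : ℤ), -(b : ℤ)] + c)) '' (bottomSide (b - a) (2 * b) : Set (Site 2)))
      ((· + (![(a : ℤ), -(b : ℤ)] + c)) '' (topSide (b - a) (2 * b) : Set (Site 2))) with hORd
    have uT : IsUpperSet OT := isUpperSet_lrCrossingAt _ _ _
    have uB : IsUpperSet OB := isUpperSet_lrCrossingAt _ _ _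
    have uL : IsUpperSet OL := isUpperSet_openCrossing _ _ _
    have uR : IsUpperSet OR := isUpperSet_openCrossing _ _ _
    have mT : MeasurableSet OT := measurableSet_lrCrossingAt _ _ _
    have mB : MeasurableSet OB := measurableSet_lrCrossingAt _ _ _
    have mL : MeasurableSet OL := measurableSet_tbCrossingAt _ _ _
    have mR : MeasurableSet OR := measurableSet_tbCrossingAt _ _ _
    have i1 := hPA.real uT uB mT mB
    have i2 := hPA.real (uT.inter uB) uL (mT.inter mB) mL
    have i3 := hPA.real ((uT.inter uB).inter uL) uR ((mT.inter mB).inter mL) mR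
    have hnn : ∀ E : Set (BondConfig (Site 2)), 0 ≤ (M k (γ s).1 (γ s).2).real E :=
      fun E => measureReal_nonneg
    calc c₁ ^ 4 = c₁ * c₁ * c₁ * c₁ := by ring
      _ ≤ (M k (γ s).1 (γ s).2).real OT * (M k (γ s).1 (γ s).2).real OB *
            (M k (γ s).1 (γ s).2).real OL * (M k (γ s).1 (γ s).2).real OR :=
          mul_le_mul (mul_le_mul (mul_le_mul hOT hOB hc₁.le (hnn _)) hOL hc₁.le
            (mul_nonneg (hnn _) (hnn _))) hOR hc₁.le
            (mul_nonneg (mul_nonneg (hnn _) (hnn _)) (hnn _))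
      _ ≤ (M k (γ s).1 (γ s).2).real (OT ∩ OB) * (M k (γ s).1 (γ s).2).real OL *
            (M k (γ s).1 (γ s).2).real OR :=
          mul_le_mul_of_nonneg_right (mul_le_mul_of_nonneg_right i1 (hnn _)) (hnn _)
      _ ≤ (M k (γ s).1 (γ s).2).real (OT ∩ OB ∩ OL) * (M k (γ s).1 (γ s).2).real OR :=
          mul_le_mul_of_nonneg_right i2 (hnn _)
      _ ≤ (M k (γ s).1 (γ s).2).real (OT ∩ OB ∩ OL ∩ OR) := i3
      _ ≤ (M k (γ s).1 (γ s).2).real (openCircuitInAnnulusAt c a b) := by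
          refine ENNReal.toReal_mono (measure_ne_top _ _) (measure_mono_ae ?_)
          filter_upwards [hae] with ω hω hmem
          exact mem_openCircuitInAnnulusAt_of_crossings ha1 hab c hω hmem.1.1.1 hmem.1.1.2
            hmem.1.2 hmem.2
  · -- dual circuit: Harris–FKG for the four decreasing complements, then planar duality
    refine (min_le_right _ _).trans ?_
    set PT := openCrossing
      ((· + (![(1 : ℤ), 0] + (![-(b : ℤ), (a : ℤ)] + c))) '' (rectangle (2 * b - 1) (b - a + 1) : Set (Site 2)))
      ((· + (![(1 : ℤ), 0] + (![-(b : ℤ), (a : ℤ)] + c))) '' (bottomSide (2 * b - 1) (b - a + 1) : Set (Site 2)))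
      ((· + (![(1 : ℤ), 0] + (![-(b : ℤ), (a : ℤ)] + c))) '' (topSide (2 * b - 1) (b - a + 1) : Set (Site 2)))
      with hPTd
    set PB := openCrossing
      ((· + (![(1 : ℤ), 0] + (![-(b : ℤ), -(b : ℤ)] + c))) '' (rectangle (2 * b - 1) (b - a + 1) : Set (Site 2)))
      ((· + (![(1 : ℤ), 0] + (![-(b : ℤ), -(b : ℤ)] + c))) '' (bottomSide (2 * b - 1) (b - a + 1) : Set (Site 2)))
      ((· + (![(1 : ℤ), 0] + (![-(b : ℤ), -(b : ℤ)] + c))) '' (topSide (2 * b - 1) (b - a + 1) : Set (Site 2)))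
      with hPBd
    set PL := lrCrossingAt (![(0 : ℤ), 1] + (![-(b : ℤ), -(b : ℤ)] + c)) (b - a + 1) (2 * b - 1) with hPLd
    set PR := lrCrossingAt (![(0 : ℤ), 1] + (![(a : ℤ), -(b : ℤ)] + c)) (b - a + 1) (2 * b - 1) with hPRd
    have mT : MeasurableSet PT := measurableSet_tbCrossingAt _ _ _
    have mB : MeasurableSet PB := measurableSet_tbCrossingAt _ _ _
    have mL : MeasurableSet PL := measurableSet_lrCrossingAt _ _ _
    have mR : MeasurableSet PR := measurableSet_lrCrossingAt _ _ _
    have lT : IsLowerSet PTᶜ := (isUpperSet_openCrossing _ _ _).compl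
    have lB : IsLowerSet PBᶜ := (isUpperSet_openCrossing _ _ _).compl
    have lL : IsLowerSet PLᶜ := (isUpperSet_lrCrossingAt _ _ _).compl
    have lR : IsLowerSet PRᶜ := (isUpperSet_lrCrossingAt _ _ _).compl
    have cT : c₂ ≤ (M k (γ s).1 (γ s).2).real PTᶜ := by rw [probReal_compl_eq_one_sub mT]; linarith
    have cB : c₂ ≤ (M k (γ s).1 (γ s).2).real PBᶜ := by rw [probReal_compl_eq_one_sub mB]; linarith
    have cL : c₂ ≤ (M k (γ s).1 (γ s).2).real PLᶜ := by rw [probReal_compl_eq_one_sub mL]; linarith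
    have cR : c₂ ≤ (M k (γ s).1 (γ s).2).real PRᶜ := by rw [probReal_compl_eq_one_sub mR]; linarith
    -- Harris–FKG for decreasing events, in `μ.real` form
    have lowFKG : ∀ {A B : Set (BondConfig (Site 2))}, IsLowerSet A → IsLowerSet B →
        MeasurableSet A → MeasurableSet B →
        (M k (γ s).1 (γ s).2).real A * (M k (γ s).1 (γ s).2).real B ≤
          (M k (γ s).1 (γ s).2).real (A ∩ B) := fun hA hB hAm hBm => by
      have h' := hPA.lowerSet hA hB hAm hBm
      rw [measureReal_def, measureReal_def, measureReal_def, ← ENNReal.toReal_mul]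
      exact ENNReal.toReal_mono (measure_ne_top _ _) h'
    have i1 := lowFKG lT lB mT.compl mB.compl
    have i2 := lowFKG (lT.inter lB) lL (mT.compl.inter mB.compl) mL.compl
    have i3 := lowFKG ((lT.inter lB).inter lL) lR ((mT.compl.inter mB.compl).inter mL.compl) mR.compl
    have hnn : ∀ E : Set (BondConfig (Site 2)), 0 ≤ (M k (γ s).1 (γ s).2).real E :=
      fun E => measureReal_nonneg
    calc c₂ ^ 4 = c₂ * c₂ * c₂ * c₂ := by ring
      _ ≤ (M k (γ s).1 (γ s).2).real PTᶜ * (M k (γ s).1 (γ s).2).real PBᶜ *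
            (M k (γ s).1 (γ s).2).real PLᶜ * (M k (γ s).1 (γ s).2).real PRᶜ :=
          mul_le_mul (mul_le_mul (mul_le_mul cT cB hc₂.le (hnn _)) cL hc₂.le
            (mul_nonneg (hnn _) (hnn _))) cR hc₂.le
            (mul_nonneg (mul_nonneg (hnn _) (hnn _)) (hnn _))
      _ ≤ (M k (γ s).1 (γ s).2).real (PTᶜ ∩ PBᶜ) * (M k (γ s).1 (γ s).2).real PLᶜ *
            (M k (γ s).1 (γ s).2).real PRᶜ :=
          mul_le_mul_of_nonneg_right (mul_le_mul_of_nonneg_right i1 (hnn _)) (hnn _)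
      _ ≤ (M k (γ s).1 (γ s).2).real (PTᶜ ∩ PBᶜ ∩ PLᶜ) * (M k (γ s).1 (γ s).2).real PRᶜ :=
          mul_le_mul_of_nonneg_right i2 (hnn _)
      _ ≤ (M k (γ s).1 (γ s).2).real (PTᶜ ∩ PBᶜ ∩ PLᶜ ∩ PRᶜ) := i3
      _ ≤ (M k (γ s).1 (γ s).2).real (dualCircuitInAnnulusAt c a b) := by
          refine ENNReal.toReal_mono (measure_ne_top _ _) (measure_mono_ae ?_)
          filter_upwards [hae] with ω hω hmem
          exact mem_dualCircuitInAnnulusAt_of_not_crossings ha1 hab c hω hmem.1.1.1 hmem.1.1.2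
            hmem.1.2 hmem.2

end Summit.CriticalPhenomena.CardyFormulaZ2.Theorems.CardySelfRefinement.FarField

end
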